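import Summits.Ventures.Crystal3D.Theorems.StickyWulffConstantCoaxialWallLawSeamThreePayerSplit
import Summits.Ventures.Crystal3D.Theorems.StickyWulffConstantCoaxialWallLawSeamCrossEndUnsaturated
import HarnessLib

/-!
# `ThreePayer` split by reader type, E1 form: the deg-12 census is needed only at NARROW and GLIDE ends
# (crux `CoaxialWallLaw`, stmt-Ventures-19481; lane F 'Certificates' v8.3R, registered stub `stub_threePayer`, cf-p1 (cclxxxi) prong (L2))

HONEST FRAMING. Venture `Summits/Ventures/Crystal3D` (cell `crystal3d-full`); sequel of '…SeamThreePayerSplit' (`threePayer_of_kinds : SatCensus12 → SatCensus11Full →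
SatCensus11Narrow → SatCensus11Glide → SatCensus11Cross → ThreePayer`).  With E1 (`P5Exhaustion`, registered `stub_E1`) FULL- and CROSS-reader end balls have at most
eleven contacts ('…SeamFullEndUnsaturated', '…SeamCrossEndUnsaturated'), so the deg-12 input `SatCensus12` (⇐ the one-free-pair certificate G12′, '…SeamSatCensusTwelve')
is only consumed at NARROW and GLIDE ends.  This file names the two restricted deg-12 facts and proves the refined glue.
* `SatCensus12Narrow`, `SatCensus12Glide` — «a saturated (A)-end ball of that kind has contact-neighbours of total deficiency ≥ 3» (data of `IsEndPairA` as hypotheses);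
  `satCensus12Kinds_of_satCensus12` (the unrestricted fact implies both, via END-BALL RIGIDITY);
* **`threePayer_of_kinds_E1 : P5Exhaustion → SatCensus12Narrow → SatCensus12Glide → SatCensus11Full → SatCensus11Narrow → SatCensus11Glide → SatCensus11Cross →
  ThreePayer`**.
WHAT THIS IS NOT: no piece is proved; F-C1 not moved.
-/

noncomputable section

namespace Summit.Ventures.Crystal3D.Theorems

namespace TailResidue

open Summit.Ventures.Crystal3D Finset
open Literature.Geometry.DiscreteGeometry (fccKissingPattern hcpKissingPattern IsArrangedIn)
open scoped InnerProductSpace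

/-! ### The deg-12 census at NARROW and GLIDE ends -/

open scoped Classical in
/-- **Deg-12 census at NARROW ends (named input; version `v2`)**: a SATURATED end ball of a NARROW move has contact-neighbours of total deficiency `≥ 3`
(implied by `SatCensus12`, since its shell is not arranged — END-BALL RIGIDITY). -/
def SatCensus12Narrow : Prop :=
  ∀ X : Finset (EuclideanSpace ℝ (Fin 3)), (∀ p ∈ X, ∀ p' ∈ X, p ≠ p' → 1 ≤ dist p p') →
  ∀ v : WordVersion, ∀ S₁ S₂ : PlateSystem, S₁.RT ⊆ fccSlots → S₂.RT ⊆ fccSlots →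
  ∀ b q : EuclideanSpace ℝ (Fin 3), ∀ G : EuclideanSpace ℝ (Fin 3) ≃ₗᵢ[ℝ] EuclideanSpace ℝ (Fin 3), ∀ d : EuclideanSpace ℝ (Fin 3),
    q ∈ X → b ∈ X → HasTwoPayers X b → (S₁.Adm G d ∨ S₂.Adm G d) → q - d ∈ X →
    (v = WordVersion.v2 ∧ IsNarrow X G d q) → b = q + d → ¬ IsMoving X v G d b →
    (X.filter fun x => dist b x = 1).card = 12 →
    3 ≤ ∑ y ∈ X.filter (fun y => dist b y = 1 ∧ (X.filter fun x => dist y x = 1).card ≤ 11), ((12 : ℝ) - ((X.filter fun x => dist y x = 1).card : ℝ))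

open scoped Classical in
/-- **Deg-12 census at GLIDE ends (named input)**: the same for a GLIDE move (twin reading `(G, m)` of `q`, `⟪d, m⟫ = 0`). -/
def SatCensus12Glide : Prop :=
  ∀ X : Finset (EuclideanSpace ℝ (Fin 3)), (∀ p ∈ X, ∀ p' ∈ X, p ≠ p' → 1 ≤ dist p p') →
  ∀ v : WordVersion, ∀ S₁ S₂ : PlateSystem, S₁.RT ⊆ fccSlots → S₂.RT ⊆ fccSlots →
  ∀ b q : EuclideanSpace ℝ (Fin 3), ∀ G : EuclideanSpace ℝ (Fin 3) ≃ₗᵢ[ℝ] EuclideanSpace ℝ (Fin 3), ∀ d : EuclideanSpace ℝ (Fin 3),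
    q ∈ X → b ∈ X → HasTwoPayers X b → (S₁.Adm G d ∨ S₂.Adm G d) → q - d ∈ X →
    (∃ m, IsTwinReading X G m q ∧ ⟪d, m⟫_ℝ = 0) → b = q + d → ¬ IsMoving X v G d b →
    (X.filter fun x => dist b x = 1).card = 12 →
    3 ≤ ∑ y ∈ X.filter (fun y => dist b y = 1 ∧ (X.filter fun x => dist y x = 1).card ≤ 11), ((12 : ℝ) - ((X.filter fun x => dist y x = 1).card : ℝ))

/-- The unrestricted `SatCensus12` implies both restricted facts (the shell of an (A)-end ball is not arranged: `not_arranged_of_isEndPairA`). -/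
theorem satCensus12Kinds_of_satCensus12 (h : SatCensus12) : SatCensus12Narrow ∧ SatCensus12Glide := by
  constructor
  · intro X hX v S₁ S₂ h₁ h₂ b q G d hq hb h2p hadm hpred hn hbq hnm h12
    have hp : IsEndPairA X v S₁ S₂ b q := ⟨hq, hb, h2p, G, d, hadm, hpred, Or.inl ⟨Or.inr (Or.inl hn), hbq, hnm⟩⟩
    exact h X hX b hb h12 (not_arranged_of_isEndPairA h₁ h₂ hp)
  · intro X hX v S₁ S₂ h₁ h₂ b q G d hq hb h2p hadm hpred hg hbq hnm h12
    have hp : IsEndPairA X v S₁ S₂ b q := ⟨hq, hb, h2p, G, d, hadm, hpred, Or.inl ⟨Or.inr (Or.inr hg), hbq, hnm⟩⟩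
    exact h X hX b hb h12 (not_arranged_of_isEndPairA h₁ h₂ hp)

/-! ### The refined glue -/

open scoped Classical in
/-- **Deg-12 census at any (A)-end ball, from E1 and the two restricted facts**: FULL and CROSS ends cannot be saturated ('…SeamFullEndUnsaturated',
'…SeamCrossEndUnsaturated'), NARROW and GLIDE ends are covered by the named inputs. -/
theorem census12_of_isEndPairA (hE1 : P5Exhaustion) (cN : SatCensus12Narrow) (cG : SatCensus12Glide)
    {X : Finset (EuclideanSpace ℝ (Fin 3))} (hX : ∀ p ∈ X, ∀ p' ∈ X, p ≠ p' → 1 ≤ dist p p') {v : WordVersion} {S₁ S₂ : PlateSystem}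
    (h₁ : S₁.RT ⊆ fccSlots) (h₂ : S₂.RT ⊆ fccSlots) {b q : EuclideanSpace ℝ (Fin 3)} (hp : IsEndPairA X v S₁ S₂ b q)
    (h12 : (X.filter fun x => dist b x = 1).card = 12) :
    3 ≤ ∑ y ∈ X.filter (fun y => dist b y = 1 ∧ (X.filter fun x => dist y x = 1).card ≤ 11), ((12 : ℝ) - ((X.filter fun x => dist y x = 1).card : ℝ)) := by
  obtain ⟨hq, hb, h2p, G, d, hadm, hpred, hmove⟩ := hp
  rcases hmove with ⟨hrd, hbq, hnm⟩ | hcross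
  · rcases hrd with hf | hn | hg
    · have := card_contacts_le_eleven_of_isEndPairA_full hE1 hX h₁ h₂ hq hadm hf hbq hnm
      omega
    · exact cN X hX v S₁ S₂ h₁ h₂ b q G d hq hb h2p hadm hpred hn hbq hnm h12
    · exact cG X hX v S₁ S₂ h₁ h₂ b q G d hq hb h2p hadm hpred hg hbq hnm h12
  · have := card_contacts_le_eleven_of_isEndPairA_cross hE1 hX h₁ h₂ hq hadm hcross
    omega

open scoped Classical in
/-- **`ThreePayer` FROM E1 AND THE SIX KIND-RESTRICTED CENSUS FACTS.** -/
theorem threePayer_of_kinds_E1 (hE1 : P5Exhaustion) (c12N : SatCensus12Narrow) (c12G : SatCensus12Glide) (cF : SatCensus11Full) (cN : SatCensus11Narrow)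
    (cG : SatCensus11Glide) (cC : SatCensus11Cross) : ThreePayer := by
  intro Y hY z hz hdeg v S₁ S₂ h₁ h₂ b q hzb hbz hp
  have hb : b ∈ Y := hp.2.1
  set S := Y.filter (fun y => dist b y ≤ 1 ∧ (Y.filter fun x => dist y x = 1).card ≤ 11) with hS
  have hterm : ∀ y ∈ S, (1 : ℝ) ≤ (12 : ℝ) - ((Y.filter fun x => dist y x = 1).card : ℝ) := by
    intro y hy
    have : ((Y.filter fun x => dist y x = 1).card : ℝ) ≤ 11 := by exact_mod_cast (mem_filter.1 hy).2.2
    linarith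
  have hnonneg : ∀ y ∈ S, (0 : ℝ) ≤ (12 : ℝ) - ((Y.filter fun x => dist y x = 1).card : ℝ) := fun y hy => (zero_le_one.trans (hterm y hy))
  have hzS : z ∈ S := mem_filter.2 ⟨hz, by rwa [dist_comm], hdeg⟩
  have h12b := card_filter_dist_eq_one_le_twelve Y hY b
  unfold pooledDef
  by_cases h10 : (Y.filter fun x => dist b x = 1).card ≤ 10
  · have hbS : b ∈ S := mem_filter.2 ⟨hb, by simp, by omega⟩
    have hsub : ({b, z} : Finset (EuclideanSpace ℝ (Fin 3))) ⊆ S := insert_subset hbS (singleton_subset_iff.2 hzS)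
    have hbterm : (2 : ℝ) ≤ (12 : ℝ) - ((Y.filter fun x => dist b x = 1).card : ℝ) := by
      have : ((Y.filter fun x => dist b x = 1).card : ℝ) ≤ 10 := by exact_mod_cast h10
      linarith
    calc (3 : ℝ) ≤ ((12 : ℝ) - ((Y.filter fun x => dist b x = 1).card : ℝ)) + ((12 : ℝ) - ((Y.filter fun x => dist z x = 1).card : ℝ)) := by
          linarith [hterm z hzS]
      _ = ∑ y ∈ ({b, z} : Finset (EuclideanSpace ℝ (Fin 3))), ((12 : ℝ) - ((Y.filter fun x => dist y x = 1).card : ℝ)) := by rw [sum_pair hbz]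
      _ ≤ ∑ y ∈ S, ((12 : ℝ) - ((Y.filter fun x => dist y x = 1).card : ℝ)) := sum_le_sum_of_subset_of_nonneg hsub fun y hy _ => hnonneg y hy
  · by_cases h11 : (Y.filter fun x => dist b x = 1).card = 11
    · obtain ⟨y, hy, y', hy', hne, hd, hd', hle, hle'⟩ := two_unsaturated_of_isEndPairA_eleven cF cN cG cC hY h₁ h₂ hp h11
      have hbS : b ∈ S := mem_filter.2 ⟨hb, by simp, by omega⟩
      have hyS : y ∈ S := mem_filter.2 ⟨hy, hd.le, hle⟩
      have hy'S : y' ∈ S := mem_filter.2 ⟨hy', hd'.le, hle'⟩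
      have hby : b ≠ y := fun h => by rw [← h, dist_self] at hd; exact zero_ne_one hd
      have hby' : b ≠ y' := fun h => by rw [← h, dist_self] at hd'; exact zero_ne_one hd'
      have hsub : ({b, y, y'} : Finset (EuclideanSpace ℝ (Fin 3))) ⊆ S := insert_subset hbS (insert_subset hyS (singleton_subset_iff.2 hy'S))
      have hcard : ({b, y, y'} : Finset (EuclideanSpace ℝ (Fin 3))).card = 3 := by
        rw [card_insert_of_notMem (by simp [hby, hby']), card_pair hne]
      calc (3 : ℝ) = ∑ _y ∈ ({b, y, y'} : Finset (EuclideanSpace ℝ (Fin 3))), (1 : ℝ) := by simp [hcard]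
        _ ≤ ∑ w ∈ ({b, y, y'} : Finset (EuclideanSpace ℝ (Fin 3))), ((12 : ℝ) - ((Y.filter fun x => dist w x = 1).card : ℝ)) :=
            sum_le_sum fun w hw => hterm w (hsub hw)
        _ ≤ ∑ w ∈ S, ((12 : ℝ) - ((Y.filter fun x => dist w x = 1).card : ℝ)) := sum_le_sum_of_subset_of_nonneg hsub fun w hw _ => hnonneg w hw
    · have h12 : (Y.filter fun x => dist b x = 1).card = 12 := by omega
      have hsum := census12_of_isEndPairA hE1 c12N c12G hY h₁ h₂ hp h12
      refine hsum.trans (sum_le_sum_of_subset_of_nonneg (fun y hy => ?_) fun y hy _ => hnonneg y hy)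
      obtain ⟨hyY, hd, hle⟩ := mem_filter.1 hy
      exact mem_filter.2 ⟨hyY, hd.le, hle⟩

end TailResidue

end Summit.Ventures.Crystal3D.Theorems

end
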